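import Literature.MathematicalPhysics.KineticTheory.LambertianRedrawNondegenerate
import Mathlib.Analysis.SpecialFunctions.Integrals.Basic
import HarnessLib

/-!
# The geometry-uniform Povzner inequality of the Lambertian (cosine) redraw

Support theorem for the crux `LambertianContactSwap.LambertianEuler`
(stmt-AtomisticToContinuum-11854), line `Sketch`, stub `stub_lambertPovzner`.

Let `γ = stdGaussian V3` be the standard Gaussian of `ℝ³`, `ω ≠ 0` a contact normal and
`n = lambertDir ω ξ = normalize(ω̂ + ξ̂)` the Lambertian redrawn direction (`ω̂ = ω/‖ω‖`,
`ξ̂ = ξ/‖ξ‖`). Granted, as hypotheses,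

* *Archimedes' hat-box theorem* `hA`: for a unit vector `e`, `⟪e, ξ⟫/‖ξ‖` is uniform on `[-1, 1]`
  under `γ` (`lintegral` form), and
* the *Lambert cosine law* `hL`: `∫ F(lambertDir ω ξ) dγ = ∫ 4 (⟪ω̂, ξ̂⟫)₊ F(ξ̂) dγ`,

we prove the **geometry-uniform Povzner inequality with the sharp constant**: for every `c` with
`‖c‖ ≤ 1` and every `k : ℕ`,

`∫ ((1 + ⟪c, n⟫)^k + (1 - ⟪c, n⟫)^k) dγ(ξ) ≤ 4 · 2^k / (k + 1)`.

Proof. By `hL` and the reflection symmetry `ξ ↦ -ξ` of `γ` (which flips `ξ̂` and turns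
`(1 - ⟪c, ξ̂⟫)^k` into `(1 + ⟪c, ξ̂⟫)^k`) the left side equals
`∫ 4 |⟪ω̂, ξ̂⟫| (1 + ⟪c, ξ̂⟫)^k dγ ≤ 4 ∫ (1 + ‖c‖ ⟪ĉ, ξ⟫/‖ξ‖)^k dγ = 2 ∫_{-1}^{1} (1 + ‖c‖ t)^k dt`
(Archimedes in the direction `ĉ = c/‖c‖`; `c = 0` is trivial since `k + 1 ≤ 2^k`)
`= 2 ((1+r)^{k+1} - (1-r)^{k+1}) / (r (k+1)) ≤ 4 · 2^k/(k+1)`, `r = ‖c‖ ∈ (0, 1]`, by the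
elementary inequality `(1+r)^m - (1-r)^m ≤ 2^m r` (joint induction with
`(1+r)^m + (1-r)^m ≤ 2^m`, `m ≥ 1`). Folklore; no definitions, no named facts.
-/

noncomputable section

namespace Summit.AtomisticToContinuum.HydrodynamicLimit.Theorems.LambertianContactSwapLambertianEulerPovzner

open scoped ENNReal InnerProductSpace
open MeasureTheory ProbabilityTheory Set
open Literature.MathematicalPhysics.KineticTheory

/-! ### Elementary real inequalities and the one-dimensional integral -/

/-- For `0 ≤ r ≤ 1` and `m ≥ 1`: `(1+r)^m - (1-r)^m ≤ 2^m r` and `(1+r)^m + (1-r)^m ≤ 2^m`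
(joint induction on `m`). [folklore] -/
theorem pow_sub_pow_le_and_pow_add_pow_le {r : ℝ} (hr0 : 0 ≤ r) (hr1 : r ≤ 1) (m : ℕ) :
    (1 + r) ^ (m + 1) - (1 - r) ^ (m + 1) ≤ 2 ^ (m + 1) * r ∧
      (1 + r) ^ (m + 1) + (1 - r) ^ (m + 1) ≤ 2 ^ (m + 1) := by
  induction m with
  | zero => refine ⟨?_, ?_⟩ <;> simp only [zero_add, pow_one] <;> linarith
  | succ m ih =>
    obtain ⟨h1, h2⟩ := ih
    have hsq : 2 ^ (m + 1) * (r * r) ≤ 2 ^ (m + 1) * 1 :=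
      mul_le_mul_of_nonneg_left (mul_le_one₀ hr1 hr0 hr1) (by positivity)
    refine ⟨?_, ?_⟩
    · have : (1 + r) ^ (m + 1 + 1) - (1 - r) ^ (m + 1 + 1) =
          ((1 + r) ^ (m + 1) - (1 - r) ^ (m + 1)) +
            r * ((1 + r) ^ (m + 1) + (1 - r) ^ (m + 1)) := by
        ring
      rw [this, pow_succ (2 : ℝ) (m + 1)]
      nlinarith [mul_le_mul_of_nonneg_left h2 hr0]
    · have : (1 + r) ^ (m + 1 + 1) + (1 - r) ^ (m + 1 + 1) =
          ((1 + r) ^ (m + 1) + (1 - r) ^ (m + 1)) +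
            r * ((1 + r) ^ (m + 1) - (1 - r) ^ (m + 1)) := by
        ring
      rw [this, pow_succ (2 : ℝ) (m + 1)]
      nlinarith [mul_le_mul_of_nonneg_left h1 hr0]

/-- `∫_{-1}^{1} (1 + r t)^k dt = ((1+r)^{k+1} - (1-r)^{k+1}) / (r (k+1))` for `r ≠ 0`
(substitution `x = r t + 1` and `∫ x^k`). [folklore] -/
theorem integral_one_add_mul_pow {r : ℝ} (hr : r ≠ 0) (k : ℕ) :
    ∫ t in (-1 : ℝ)..1, (1 + r * t) ^ k =
      ((1 + r) ^ (k + 1) - (1 - r) ^ (k + 1)) / (r * (k + 1)) := by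
  have h := intervalIntegral.integral_comp_mul_add (a := -1) (b := 1) (fun x : ℝ => x ^ k) hr 1
  simp only [mul_neg, mul_one] at h
  simp_rw [show ∀ t : ℝ, 1 + r * t = r * t + 1 from fun t => add_comm _ _]
  rw [h, integral_pow, smul_eq_mul]
  have hk : (k : ℝ) + 1 ≠ 0 := by positivity
  field_simp
  ring

/-- `∫⁻_{[-1,1]} (1 + r t)^k dt ≤ 2^{k+1}/(k+1)` for `0 < r ≤ 1`, as an `ℝ≥0∞` bound
(the exact value is `((1+r)^{k+1} - (1-r)^{k+1})/(r(k+1))`). [folklore] -/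
theorem lintegral_Icc_one_add_mul_pow_le {r : ℝ} (hr0 : 0 < r) (hr1 : r ≤ 1) (k : ℕ) :
    ∫⁻ t in Icc (-1 : ℝ) 1, ENNReal.ofReal ((1 + r * t) ^ k) ≤
      ENNReal.ofReal (2 ^ (k + 1) / (k + 1)) := by
  have hcont : Continuous fun t : ℝ => (1 + r * t) ^ k := by fun_prop
  have hnn : ∀ t ∈ Icc (-1 : ℝ) 1, 0 ≤ (1 + r * t) ^ k := fun t ht =>
    pow_nonneg (by nlinarith [ht.1, hr0.le, hr1]) k
  rw [← ofReal_integral_eq_lintegral_ofReal hcont.integrableOn_Icc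
      (ae_restrict_of_forall_mem measurableSet_Icc hnn)]
  refine ENNReal.ofReal_le_ofReal ?_
  rw [integral_Icc_eq_integral_Ioc, ← intervalIntegral.integral_of_le (by norm_num : (-1 : ℝ) ≤ 1),
    integral_one_add_mul_pow hr0.ne' k, div_le_div_iff₀ (by positivity) (by positivity)]
  have h := (pow_sub_pow_le_and_pow_add_pow_le hr0.le hr1 k).1
  have hk : (0 : ℝ) < k + 1 := by positivity
  nlinarith [mul_le_mul_of_nonneg_right h hk.le]

/-! ### Normalised vectors and the reflected cosine weight -/

/-- `‖x/‖x‖‖ ≤ 1` (it is `1`, or `0` at the origin). [folklore] -/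
theorem norm_inv_norm_smul_le_one (x : V3) : ‖‖x‖⁻¹ • x‖ ≤ 1 := by
  rw [norm_smul, norm_inv, norm_norm]
  exact inv_mul_le_one

/-- `|⟪ω̂, ξ̂⟫| ≤ 1` for the normalised vectors `ω̂ = ω/‖ω‖`, `ξ̂ = ξ/‖ξ‖`. [folklore] -/
theorem abs_inner_hat_le_one (ω ξ : V3) : |⟪‖ω‖⁻¹ • ω, ‖ξ‖⁻¹ • ξ⟫_ℝ| ≤ 1 :=
  (abs_real_inner_le_norm _ _).trans
    (mul_le_one₀ (norm_inv_norm_smul_le_one ω) (norm_nonneg _) (norm_inv_norm_smul_le_one ξ))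

/-- The cosine weight and its reflection add up to at most `4`:
`4 t₊ + 4 (-t)₊ = 4 |t| ≤ 4` for `|t| ≤ 1` (in `ℝ≥0∞`). [folklore] -/
theorem ofReal_weight_add_ofReal_weight_neg_le {t : ℝ} (ht : |t| ≤ 1) :
    ENNReal.ofReal (4 * max t 0) + ENNReal.ofReal (4 * max (-t) 0) ≤ 4 := by
  rw [← ENNReal.ofReal_add (by positivity) (by positivity), ← mul_add,
    max_zero_add_max_neg_zero_eq_abs_self]
  calc ENNReal.ofReal (4 * |t|) ≤ ENNReal.ofReal 4 := ENNReal.ofReal_le_ofReal (by linarith)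
    _ = 4 := ENNReal.ofReal_ofNat 4

/-! ### Reflection symmetry of the Gaussian -/

/-- The standard Gaussian of `ℝ³` is invariant under `ξ ↦ -ξ` (a linear isometry). [folklore] -/
theorem stdGaussian_map_neg : (stdGaussian V3).map (fun ξ : V3 => -ξ) = stdGaussian V3 := by
  simpa using stdGaussian_map (E := V3) (LinearIsometryEquiv.neg ℝ)

/-- Reflection invariance of Gaussian `lintegral`s: `∫ g(-ξ) dγ(ξ) = ∫ g dγ`. [folklore] -/
theorem lintegral_stdGaussian_comp_neg (g : V3 → ℝ≥0∞) :
    ∫⁻ ξ, g (-ξ) ∂(stdGaussian V3) = ∫⁻ ξ, g ξ ∂(stdGaussian V3) := by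
  have h := lintegral_map_equiv (μ := stdGaussian V3) g (MeasurableEquiv.neg V3)
  have hcoe : ⇑(MeasurableEquiv.neg V3) = fun ξ : V3 => -ξ := rfl
  rw [hcoe, stdGaussian_map_neg] at h
  exact h.symm

/-! ### The Povzner inequality -/

/-- **Geometry-uniform Povzner inequality of the cosine redraw, sharp constant.** Granted
Archimedes' hat-box theorem for `stdGaussian V3` (`hA`: `⟪e, ξ⟫/‖ξ‖` is uniform on `[-1, 1]`
for a unit vector `e`) and the Lambert cosine law of `lambertDir ω ξ` (`hL`), for every contact
normal `ω ≠ 0`, every `c` with `‖c‖ ≤ 1` and every `k : ℕ`,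
`∫ ((1 + ⟪c, lambertDir ω ξ⟫)^k + (1 - ⟪c, lambertDir ω ξ⟫)^k) dγ(ξ) ≤ 4 · 2^k / (k + 1)`.
Reflection trick `(t)₊ + (-t)₊ = |t| ≤ 1`, Archimedes in the direction `c/‖c‖`, and
`(1+r)^{k+1} - (1-r)^{k+1} ≤ 2^{k+1} r` on `[0, 1]`. [folklore] -/
theorem lambertPovzner_of_archimedes_of_lambertLaw
    (hA : ∀ e : V3, ‖e‖ = 1 → ∀ G : ℝ → ℝ≥0∞, Measurable G →
      ∫⁻ ξ, G (⟪e, ξ⟫_ℝ / ‖ξ‖) ∂(stdGaussian V3) = 2⁻¹ * ∫⁻ t in Set.Icc (-1 : ℝ) 1, G t)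
    (hL : ∀ ω : V3, ω ≠ 0 → ∀ F : V3 → ℝ≥0∞, Measurable F →
      ∫⁻ ξ, F (lambertDir ω ξ) ∂(stdGaussian V3) =
        ∫⁻ ξ, ENNReal.ofReal (4 * max (⟪‖ω‖⁻¹ • ω, ‖ξ‖⁻¹ • ξ⟫_ℝ) 0) * F (‖ξ‖⁻¹ • ξ)
          ∂(stdGaussian V3)) :
    ∀ ω c : V3, ω ≠ 0 → ‖c‖ ≤ 1 → ∀ k : ℕ,
      ∫ ξ, ((1 + ⟪c, lambertDir ω ξ⟫_ℝ) ^ k + (1 - ⟪c, lambertDir ω ξ⟫_ℝ) ^ k) ∂(stdGaussian V3)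
        ≤ 4 * 2 ^ k / (k + 1) := by
  intro ω c hω hc k
  -- `|⟪c, n⟫| ≤ 1` whenever `‖n‖ ≤ 1`, so both bases `1 ± ⟪c, n⟫` are nonnegative.
  have hcn : ∀ n : V3, ‖n‖ ≤ 1 → |⟪c, n⟫_ℝ| ≤ 1 := fun n hn =>
    (abs_real_inner_le_norm c n).trans (mul_le_one₀ hc (norm_nonneg _) hn)
  have hpos : ∀ n : V3, ‖n‖ ≤ 1 → 0 ≤ 1 + ⟪c, n⟫_ℝ := fun n hn => by
    have := (abs_le.1 (hcn n hn)).1; linarith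
  have hneg : ∀ n : V3, ‖n‖ ≤ 1 → 0 ≤ 1 - ⟪c, n⟫_ℝ := fun n hn => by
    have := (abs_le.1 (hcn n hn)).2; linarith
  -- measurability bookkeeping
  have hmn : Measurable fun ξ : V3 => lambertDir ω ξ := measurable_const.lambertDir measurable_id
  have hmhat : Measurable fun ξ : V3 => ‖ξ‖⁻¹ • ξ := measurable_norm.inv.smul measurable_id
  have hFp : Measurable fun n : V3 => ENNReal.ofReal ((1 + ⟪c, n⟫_ℝ) ^ k) := by fun_prop
  have hFm : Measurable fun n : V3 => ENNReal.ofReal ((1 - ⟪c, n⟫_ℝ) ^ k) := by fun_prop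
  have hFpn : Measurable fun ξ : V3 => ENNReal.ofReal ((1 + ⟪c, lambertDir ω ξ⟫_ℝ) ^ k) :=
    hFp.comp hmn
  have hFphat : Measurable fun ξ : V3 => ENNReal.ofReal ((1 + ⟪c, ‖ξ‖⁻¹ • ξ⟫_ℝ) ^ k) :=
    hFp.comp hmhat
  have hPm : Measurable fun ξ : V3 =>
      (1 + ⟪c, lambertDir ω ξ⟫_ℝ) ^ k + (1 - ⟪c, lambertDir ω ξ⟫_ℝ) ^ k :=
    ((measurable_const.add (measurable_const.inner hmn)).pow_const k).add
      ((measurable_const.sub (measurable_const.inner hmn)).pow_const k)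
  have hWm : Measurable fun ξ : V3 =>
      ENNReal.ofReal (4 * max (⟪‖ω‖⁻¹ • ω, ‖ξ‖⁻¹ • ξ⟫_ℝ) 0) *
        ENNReal.ofReal ((1 + ⟪c, ‖ξ‖⁻¹ • ξ⟫_ℝ) ^ k) :=
    (((measurable_const.inner hmhat).max measurable_const).const_mul 4).ennreal_ofReal.mul hFphat
  -- Step 1: the Bochner integral of the nonnegative integrand is a `lintegral`.
  rw [integral_eq_lintegral_of_nonneg_ae
      (Filter.Eventually.of_forall fun ξ => add_nonneg
        (pow_nonneg (hpos _ (norm_lambertDir_le_one ω ξ)) k)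
        (pow_nonneg (hneg _ (norm_lambertDir_le_one ω ξ)) k))
      hPm.aestronglyMeasurable]
  refine ENNReal.toReal_le_of_le_ofReal (by positivity) ?_
  -- Step 2: split the integrand and apply the Lambert law to both halves.
  have hsplit : ∀ ξ : V3, ENNReal.ofReal ((1 + ⟪c, lambertDir ω ξ⟫_ℝ) ^ k +
      (1 - ⟪c, lambertDir ω ξ⟫_ℝ) ^ k) = ENNReal.ofReal ((1 + ⟪c, lambertDir ω ξ⟫_ℝ) ^ k) +
        ENNReal.ofReal ((1 - ⟪c, lambertDir ω ξ⟫_ℝ) ^ k) := fun ξ =>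
    ENNReal.ofReal_add (pow_nonneg (hpos _ (norm_lambertDir_le_one ω ξ)) k)
      (pow_nonneg (hneg _ (norm_lambertDir_le_one ω ξ)) k)
  simp_rw [hsplit]
  rw [lintegral_add_left hFpn, hL ω hω _ hFp, hL ω hω _ hFm]
  -- Step 3: reflect the second integral through `ξ ↦ -ξ` and add: the weights sum to `4|t| ≤ 4`.
  have hrefl : ∫⁻ ξ, ENNReal.ofReal (4 * max (⟪‖ω‖⁻¹ • ω, ‖ξ‖⁻¹ • ξ⟫_ℝ) 0) *
        ENNReal.ofReal ((1 - ⟪c, ‖ξ‖⁻¹ • ξ⟫_ℝ) ^ k) ∂(stdGaussian V3) =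
      ∫⁻ ξ, ENNReal.ofReal (4 * max (-⟪‖ω‖⁻¹ • ω, ‖ξ‖⁻¹ • ξ⟫_ℝ) 0) *
        ENNReal.ofReal ((1 + ⟪c, ‖ξ‖⁻¹ • ξ⟫_ℝ) ^ k) ∂(stdGaussian V3) := by
    rw [← lintegral_stdGaussian_comp_neg (fun ξ =>
      ENNReal.ofReal (4 * max (⟪‖ω‖⁻¹ • ω, ‖ξ‖⁻¹ • ξ⟫_ℝ) 0) *
        ENNReal.ofReal ((1 - ⟪c, ‖ξ‖⁻¹ • ξ⟫_ℝ) ^ k))]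
    simp_rw [norm_neg, smul_neg, inner_neg_right, sub_neg_eq_add]
  -- Step 4: Archimedes in the direction `c/‖c‖` and the one-dimensional bound.
  have hI : ∫⁻ ξ, ENNReal.ofReal ((1 + ⟪c, ‖ξ‖⁻¹ • ξ⟫_ℝ) ^ k) ∂(stdGaussian V3) ≤
      ENNReal.ofReal (2 ^ k / (k + 1)) := by
    by_cases hc0 : c = 0
    · have h1 : (1 : ℝ≥0∞) ≤ ENNReal.ofReal (2 ^ k / (k + 1)) := by
        refine ENNReal.one_le_ofReal.2 ((one_le_div (by positivity)).2 ?_)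
        exact_mod_cast (Nat.lt_two_pow_self : k < 2 ^ k)
      simpa only [hc0, inner_zero_left, add_zero, one_pow, ENNReal.ofReal_one, lintegral_const,
        measure_univ, mul_one] using h1
    · have hr0 : 0 < ‖c‖ := norm_pos_iff.2 hc0
      have he1 : ‖‖c‖⁻¹ • c‖ = 1 := norm_smul_inv_norm hc0
      have hG : Measurable fun u : ℝ => ENNReal.ofReal ((1 + ‖c‖ * u) ^ k) := by fun_prop
      have key : ∀ ξ : V3, ⟪c, ‖ξ‖⁻¹ • ξ⟫_ℝ = ‖c‖ * (⟪‖c‖⁻¹ • c, ξ⟫_ℝ / ‖ξ‖) := fun ξ => by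
        rw [real_inner_smul_right, real_inner_smul_left, ← mul_div_assoc, ← mul_assoc,
          mul_inv_cancel₀ hr0.ne', one_mul, div_eq_inv_mul]
      simp_rw [key]
      rw [hA _ he1 _ hG]
      calc 2⁻¹ * ∫⁻ t in Icc (-1 : ℝ) 1, ENNReal.ofReal ((1 + ‖c‖ * t) ^ k)
          ≤ 2⁻¹ * ENNReal.ofReal (2 ^ (k + 1) / (k + 1)) := by
            gcongr
            exact lintegral_Icc_one_add_mul_pow_le hr0 hc k
        _ = ENNReal.ofReal (2 ^ k / (k + 1)) := by
            rw [pow_succ', mul_div_assoc, ENNReal.ofReal_mul zero_le_two, ENNReal.ofReal_ofNat,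
              ← mul_assoc, ENNReal.inv_mul_cancel (by norm_num) (by norm_num), one_mul]
  -- Step 5: assemble.
  rw [hrefl, ← lintegral_add_left hWm]
  calc ∫⁻ ξ, (ENNReal.ofReal (4 * max (⟪‖ω‖⁻¹ • ω, ‖ξ‖⁻¹ • ξ⟫_ℝ) 0) *
          ENNReal.ofReal ((1 + ⟪c, ‖ξ‖⁻¹ • ξ⟫_ℝ) ^ k) +
        ENNReal.ofReal (4 * max (-⟪‖ω‖⁻¹ • ω, ‖ξ‖⁻¹ • ξ⟫_ℝ) 0) *
          ENNReal.ofReal ((1 + ⟪c, ‖ξ‖⁻¹ • ξ⟫_ℝ) ^ k)) ∂(stdGaussian V3)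
      ≤ ∫⁻ ξ, 4 * ENNReal.ofReal ((1 + ⟪c, ‖ξ‖⁻¹ • ξ⟫_ℝ) ^ k) ∂(stdGaussian V3) := by
        refine lintegral_mono fun ξ => ?_
        rw [← add_mul]
        gcongr
        exact ofReal_weight_add_ofReal_weight_neg_le (abs_inner_hat_le_one ω ξ)
    _ = 4 * ∫⁻ ξ, ENNReal.ofReal ((1 + ⟪c, ‖ξ‖⁻¹ • ξ⟫_ℝ) ^ k) ∂(stdGaussian V3) :=
        lintegral_const_mul 4 hFphat
    _ ≤ 4 * ENNReal.ofReal (2 ^ k / (k + 1)) := by gcongr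
    _ = ENNReal.ofReal (4 * 2 ^ k / (k + 1)) := by
        rw [mul_div_assoc, ENNReal.ofReal_mul (by norm_num : (0 : ℝ) ≤ 4), ENNReal.ofReal_ofNat]

/-- Registered stub `stub_lambertPovzner` of line `Sketch` (crux stmt-AtomisticToContinuum-11854):
`ArchimedesV3 → LambertLaw → LambertPovzner` with the registered bodies verbatim. [folklore] -/
theorem stub_lambertPovzner :
    (∀ e : V3, ‖e‖ = 1 → ∀ G : ℝ → ℝ≥0∞, Measurable G →
        ∫⁻ ξ, G (⟪e, ξ⟫_ℝ / ‖ξ‖) ∂(stdGaussian V3) = 2⁻¹ * ∫⁻ t in Set.Icc (-1 : ℝ) 1, G t) →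
    (∀ ω : V3, ω ≠ 0 → ∀ F : V3 → ℝ≥0∞, Measurable F →
        ∫⁻ ξ, F (lambertDir ω ξ) ∂(stdGaussian V3) =
          ∫⁻ ξ, ENNReal.ofReal (4 * max (⟪‖ω‖⁻¹ • ω, ‖ξ‖⁻¹ • ξ⟫_ℝ) 0) * F (‖ξ‖⁻¹ • ξ)
            ∂(stdGaussian V3)) →
    ∀ ω c : V3, ω ≠ 0 → ‖c‖ ≤ 1 → ∀ k : ℕ,
      ∫ ξ, ((1 + ⟪c, lambertDir ω ξ⟫_ℝ) ^ k + (1 - ⟪c, lambertDir ω ξ⟫_ℝ) ^ k) ∂(stdGaussian V3)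
        ≤ 4 * 2 ^ k / (k + 1) :=
  fun hA hL => lambertPovzner_of_archimedes_of_lambertLaw hA hL

end Summit.AtomisticToContinuum.HydrodynamicLimit.Theorems.LambertianContactSwapLambertianEulerPovzner

end
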